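import Literature.Analysis.FluidPDE.PassiveVectorGalerkinBlockEnergy
import Literature.Analysis.FluidPDE.PassiveVectorGalerkinModeODE
import Summits.AnomalousDissipation.AnomalousDissipation.Theorems.SolenoidalFractalHomogenisationRealisedQuasiStaticCellLawSlotWindows
import HarnessLib

/-!
# K2R `RealisedQuasiStaticCellLaw`, line `floquet-bloch`: decay of coset-invariant frequency blocks of the cell's Galerkin system
# inside one slot (helper towards `stub_lowSectorDecay` / `stub_upperSome`; `--supports stmt-AnomalousDissipation-20446`)

Summits-side helper file (everything proved; no definitions, no named facts). Inside a time window `[t₀, t₁] ⊆ [0, T]` spent in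
slot `j`, the only active carrier modes of the cell are `±K_j` (`mFourierCoeff_cell_slot_eq_zero`), so every symmetric frequency
block `F ⊆ freqBall N` which is invariant under the translations `k ↦ k ± K_j` (inside the ball) is closed under the active
couplings, and the block energy identity of `PassiveVectorGalerkinBlockEnergy` applies to the Galerkin truncation of the cell
problem: `∑_{k∈F} ‖α_N(t)(k)‖² ≤ e^{-8π²κR²(t-t₀)} ∑_{k∈F} ‖α_N(t₀)(k)‖²` whenever the truncation vanishes on the modes of `F` with
`|k|² < R²` (`restBlock_decay_slot`), in particular the block energy is non-increasing (`R = 0`). For the non-principal part of a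
low Bloch sector (`R = n/2`) this is the «fast cosets decay at the standard rate» step of the far-sector bookkeeping
(STUB-PLAN `stub_lowSectorDecay` §3.5; recipe §2).
-/

set_option linter.dupNamespace false

noncomputable section

namespace Summit.AnomalousDissipation.AnomalousDissipation.Theorems.SolenoidalFractalHomogenisation.RealisedQuasiStaticCellLaw

open Set MeasureTheory Filter Topology Function
open scoped InnerProductSpace
open Literature.Analysis Literature.Analysis.FunctionSpaces Literature.Analysis.FunctionSpaces.Torus
open Literature.Analysis.FluidPDE Literature.Analysis.FluidPDE.LatticeShear

variable {k₀ : ℕ}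

/-- **Decay of a coset-invariant block inside a slot window.** For the Galerkin truncation of order `N` (carrier resolved)
of the cell problem (`pvSetup_cell`), a window `[t₀, t₁] ⊆ [0, T]` in slot `j`, and a symmetric block `F ⊆ freqBall N`
invariant under `k ↦ k ± K_j` inside the ball, on whose modes with `|k|² < R²` the truncation vanishes throughout the window:
`∑_{k∈F} ‖α_N(t)(k)‖² ≤ e^{-8π²κR²(t-t₀)} ∑_{k∈F} ‖α_N(t₀)(k)‖²` for `t ∈ [t₀, t₁]`. -/
theorem restBlock_decay_slot (W : LatticeWord k₀) {n : ℕ} (hn : 0 < n) {κ : ℝ} (hκ : 0 ≤ κ)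
    (ℓ : Fin 3 → ℤ) {w₀ : UnitAddTorus (Fin 3) → EuclideanSpace ℝ (Fin 3)}
    (hw₀ : FunctionSpaces.Torus.MemSobolev 1 (FunctionSpaces.EuclideanSpace.complexify ∘ w₀))
    (hdiv : FunctionSpaces.Torus.IsWeaklyDivFree w₀) (hmean : FunctionSpaces.Torus.HasZeroMean w₀)
    (hsupp : ∀ k : Fin 3 → ℤ, ¬ ((∃ z : Fin 3 → ℤ, k = ℓ + (n:ℤ) • z) ∨ (∃ z : Fin 3 → ℤ, k = -ℓ + (n:ℤ) • z)) →
      UnitAddTorus.mFourierCoeff (FunctionSpaces.EuclideanSpace.complexify ∘ w₀) k = 0)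
    {N : ℕ} (hBN : (Finset.univ.biUnion fun j : Fin k₀ =>
        ({(fun i => (W.phase j).m i * n), -(fun i => (W.phase j).m i * n)} : Finset (Fin 3 → ℤ))) ⊆ freqBall N)
    {T t₀ t₁ : ℝ} (ht₀ : 0 ≤ t₀) (ht₁T : t₁ ≤ T) (j : Fin k₀)
    (hwin : ∀ t ∈ Icc t₀ t₁, Int.fract (t / W.period) * W.period ∈ Icc (W.start j) (W.start j + (W.phase j).τ))
    {F : Finset (Fin 3 → ℤ)} (hFS : F ⊆ freqBall N) (hF : ∀ k ∈ F, -k ∈ F)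
    (hFadd : ∀ k ∈ F, k + (fun i => (W.phase j).m i * (n : ℤ)) ∈ freqBall N → k + (fun i => (W.phase j).m i * (n : ℤ)) ∈ F)
    (hFsub : ∀ k ∈ F, k - (fun i => (W.phase j).m i * (n : ℤ)) ∈ freqBall N → k - (fun i => (W.phase j).m i * (n : ℤ)) ∈ F)
    {R : ℝ} (hR : ∀ t ∈ Icc t₀ t₁, ∀ k ∈ F, freqNormSq k < R ^ 2 →
      (pvSetup_cell W hn hκ ℓ hw₀ hdiv hmean hsupp).galerkinCoeffAt N t k = 0) :
    ∀ t ∈ Icc t₀ t₁,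
      ∑ k ∈ F, ‖(pvSetup_cell W hn hκ ℓ hw₀ hdiv hmean hsupp).galerkinCoeffAt N t k‖ ^ 2 ≤
        Real.exp (-(8 * Real.pi ^ 2 * κ * R ^ 2) * (t - t₀)) *
          ∑ k ∈ F, ‖(pvSetup_cell W hn hκ ℓ hw₀ hdiv hmean hsupp).galerkinCoeffAt N t₀ k‖ ^ 2 := by
  classical
  set hPV := pvSetup_cell W hn hκ ℓ hw₀ hdiv hmean hsupp with hPVdef
  set K : Fin 3 → ℤ := fun i => (W.phase j).m i * (n : ℤ) with hK
  obtain ⟨-, hmemP, -, hsol, -⟩ := hPV.galerkinCoeff_spec N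
  -- the Galerkin ODE restricted to the window
  have hα : ∀ t ∈ Icc t₀ t₁, HasDerivWithinAt (hPV.galerkinCoeff N)
      (pvGalerkinRHS (freqBall N) κ (Torus.carrierTrunc (fun t k =>
        UnitAddTorus.mFourierCoeff (EuclideanSpace.complexify ∘ W.cell n t) k) N t) (hPV.galerkinCoeff N t)) (Icc t₀ t₁) t :=
    fun t ht => (hsol T t ⟨ht₀.trans ht.1, ht.2.trans ht₁T⟩).mono (Icc_subset_Icc ht₀ ht₁T)
  have hmem : ∀ t ∈ Icc t₀ t₁, hPV.galerkinCoeff N t ∈ galerkinSubspace (freqBall N) := fun t _ => (hmemP t).1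
  -- closure of the block under the couplings active in slot `j`
  have hclosed : ∀ t ∈ Icc t₀ t₁, ∀ k ∈ F, ∀ l ∈ freqBall N, ∀ m ∈ freqBall N, l + m = k →
      coeffExt (freqBall N) (Torus.carrierTrunc (fun t k =>
        UnitAddTorus.mFourierCoeff (EuclideanSpace.complexify ∘ W.cell n t) k) N t) l ≠ 0 →
      coeffExt (freqBall N) (hPV.galerkinCoeff N t) m ≠ 0 → m ∈ F := by
    intro t ht k hk l _ m hm hlm hβl _
    rw [Torus.coeffExt_carrierTrunc_eq hPV.carrier hBN t] at hβl
    -- `β t l ≠ 0` forces `l = ±K_j`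
    have hl : l = K ∨ l = -K := by
      by_contra hcon
      push Not at hcon
      exact hβl (mFourierCoeff_cell_slot_eq_zero W hn j (hwin t ht) hcon.1 hcon.2)
    have hmk : m = k - l := by rw [← hlm]; abel
    rcases hl with rfl | rfl
    · rw [hmk] at hm ⊢
      exact hFsub k hk hm
    · rw [hmk, sub_neg_eq_add] at hm ⊢
      exact hFadd k hk hm
  have hR' : ∀ t ∈ Icc t₀ t₁, ∀ k ∈ F, freqNormSq k < R ^ 2 → coeffExt (freqBall N) (hPV.galerkinCoeff N t) k = 0 :=
    fun t ht k hk hlt => by rw [hPV.coeffExt_galerkinCoeff N t]; exact hR t ht k hk hlt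
  have h := Torus.blockEnergy_decay_of_solution κ hκ (neg_mem_freqBall_of_mem (N := N))
    (fun t => Torus.isRealCoeff_carrierTrunc hPV.carrier N t) (fun t => Torus.isSolenoidalCoeff_carrierTrunc hPV.carrier N t)
    hα hmem hFS hF hclosed hR'
  intro t ht
  have h1 := h t ht
  simp only [hPV.coeffExt_galerkinCoeff] at h1
  exact h1

/-- **Coset-invariant blocks do not gain energy inside a slot** (the case `R = 0`). -/
theorem restBlock_antitone_slot (W : LatticeWord k₀) {n : ℕ} (hn : 0 < n) {κ : ℝ} (hκ : 0 ≤ κ)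
    (ℓ : Fin 3 → ℤ) {w₀ : UnitAddTorus (Fin 3) → EuclideanSpace ℝ (Fin 3)}
    (hw₀ : FunctionSpaces.Torus.MemSobolev 1 (FunctionSpaces.EuclideanSpace.complexify ∘ w₀))
    (hdiv : FunctionSpaces.Torus.IsWeaklyDivFree w₀) (hmean : FunctionSpaces.Torus.HasZeroMean w₀)
    (hsupp : ∀ k : Fin 3 → ℤ, ¬ ((∃ z : Fin 3 → ℤ, k = ℓ + (n:ℤ) • z) ∨ (∃ z : Fin 3 → ℤ, k = -ℓ + (n:ℤ) • z)) →
      UnitAddTorus.mFourierCoeff (FunctionSpaces.EuclideanSpace.complexify ∘ w₀) k = 0)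
    {N : ℕ} (hBN : (Finset.univ.biUnion fun j : Fin k₀ =>
        ({(fun i => (W.phase j).m i * n), -(fun i => (W.phase j).m i * n)} : Finset (Fin 3 → ℤ))) ⊆ freqBall N)
    {T t₀ t₁ : ℝ} (ht₀ : 0 ≤ t₀) (ht₁T : t₁ ≤ T) (j : Fin k₀)
    (hwin : ∀ t ∈ Icc t₀ t₁, Int.fract (t / W.period) * W.period ∈ Icc (W.start j) (W.start j + (W.phase j).τ))
    {F : Finset (Fin 3 → ℤ)} (hFS : F ⊆ freqBall N) (hF : ∀ k ∈ F, -k ∈ F)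
    (hFadd : ∀ k ∈ F, k + (fun i => (W.phase j).m i * (n : ℤ)) ∈ freqBall N → k + (fun i => (W.phase j).m i * (n : ℤ)) ∈ F)
    (hFsub : ∀ k ∈ F, k - (fun i => (W.phase j).m i * (n : ℤ)) ∈ freqBall N → k - (fun i => (W.phase j).m i * (n : ℤ)) ∈ F) :
    ∀ t ∈ Icc t₀ t₁,
      ∑ k ∈ F, ‖(pvSetup_cell W hn hκ ℓ hw₀ hdiv hmean hsupp).galerkinCoeffAt N t k‖ ^ 2 ≤
        ∑ k ∈ F, ‖(pvSetup_cell W hn hκ ℓ hw₀ hdiv hmean hsupp).galerkinCoeffAt N t₀ k‖ ^ 2 := by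
  intro t ht
  have h := restBlock_decay_slot W hn hκ ℓ hw₀ hdiv hmean hsupp hBN ht₀ ht₁T j hwin hFS hF hFadd hFsub (R := 0)
    (fun τ _ k _ hk => by
      have := freqNormSq_nonneg k
      rw [sq, zero_mul] at hk
      exact absurd hk (not_lt.2 this)) t ht
  simpa using h

end Summit.AnomalousDissipation.AnomalousDissipation.Theorems.SolenoidalFractalHomogenisation.RealisedQuasiStaticCellLaw

end
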